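import Literature.NumberTheory.DiophantineGeometry.AbcShapeFourierBoundSets
import Literature.NumberTheory.DiophantineGeometry.AbcShapeGeometrySets
import Literature.NumberTheory.DiophantineGeometry.AbcShapeTrivialBound
import HarnessLib

/-!
# Exponents of the shape data (the dictionary `A_i = X^{a_i}` of BBLT §6)

In the proof of Theorem 1.3 of [BernertEtAl2024] (arXiv v2, §6) one writes every box parameter
as a power of the scale, `A_i = X^{a_i}` etc., and reads each bound for `B_d` as a linear
inequality between the exponents. Here the scale is `Λ = 2C₀` (so that `cᵢ ∏ ·^{i+1} ≤ Λ`), the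
exponent of `n` is `logb Λ n`, and we prove the dictionary entries:

* `logb` of box cardinalities, shape values, `onVal`, sub-box cardinalities as sums of exponents;
* `geometry_disjunction` — the bound of `AbcShapeGeometrySets` for index sets `I, J, K` reads
  `min(Σ_I α + Σ_J β + Σ_K γ, 1 - Σ_I i αᵢ - Σ_J i βᵢ - Σ_K i γᵢ) ≤ L - D + s`
  (inequalities (6.5)–(6.9) of [BernertEtAl2024, Prop. 6.1], as disjunctions);
* `fourier_linear` — the bound of `AbcShapeFourierBoundSets` reads
  `Σ_{S_U} α + Σ_{S_V} β + Σ_{S_W} γ ≤ 4L - 6D + s` ((6.10));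
* `trivial_linear` — `D ≤ a + b + s` etc. ((6.4));
here `D = logb Λ B_d`, `L = a + b + c`, and `s` is any number exceeding the explicit losses
(`O(d) logb Λ D_τ + O(1) logb Λ 2 + logb Λ V₂`). Theorems 1.2/1.3 are NOT proved here.

## References

* [BernertEtAl2024] C. Bernert, T. Browning, J. D. Lichtman, J. Teräväinen, *Bounds on the
  exceptional set in the abc conjecture*, arXiv:2410.12234v2, §6 (proof of Theorem 1.3).
-/

noncomputable section

open Finset

namespace Literature.NumberTheory.DiophantineGeometry

namespace AbcShapes

/-! ### Exponents -/

/-- The exponent vector of a box: `αᵢ = log_Λ Xᵢ`. [cite: BernertEtAl2024, §6] -/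
def expo (Λ : ℝ) {d : ℕ} (X : Fin d → ℕ) (i : Fin d) : ℝ :=
  Real.logb Λ (X i)

section dictionary

variable {Λ : ℝ}

/-- Exponents of positive parameters are non-negative. [folklore] -/
theorem expo_nonneg (hΛ : 1 < Λ) {d : ℕ} {X : Fin d → ℕ} (hX : ∀ i, 0 < X i) (i : Fin d) :
    0 ≤ expo Λ X i :=
  Real.logb_nonneg hΛ (by exact_mod_cast hX i)

/-- `log_Λ` of a product of positive naturals. [folklore] -/
theorem logb_natProd {ι : Type*} (s : Finset ι) {f : ι → ℕ} (hf : ∀ i ∈ s, 0 < f i) :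
    Real.logb Λ ((∏ i ∈ s, f i : ℕ) : ℝ) = ∑ i ∈ s, Real.logb Λ (f i : ℝ) := by
  push_cast
  rw [Real.logb, Real.log_prod (s := s) (f := fun i => (f i : ℝ)) fun i hi => by exact_mod_cast (hf i hi).ne', sum_div]
  rfl

/-- `log_Λ (m n) = log_Λ m + log_Λ n` for positive naturals. [folklore] -/
theorem logb_natMul {m n : ℕ} (hm : 0 < m) (hn : 0 < n) :
    Real.logb Λ ((m * n : ℕ) : ℝ) = Real.logb Λ m + Real.logb Λ n := by
  push_cast
  exact Real.logb_mul (by exact_mod_cast hm.ne') (by exact_mod_cast hn.ne')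

/-- `log_Λ (n^k) = k log_Λ n`. [folklore] -/
theorem logb_natPow (n k : ℕ) : Real.logb Λ ((n ^ k : ℕ) : ℝ) = k * Real.logb Λ n := by
  push_cast
  rw [Real.logb, Real.logb, Real.log_pow, mul_div_assoc]

/-- Monotonicity of `log_Λ` on positive naturals. [folklore] -/
theorem logb_natMono (hΛ : 1 < Λ) {m n : ℕ} (hm : 0 < m) (hmn : m ≤ n) :
    Real.logb Λ (m : ℝ) ≤ Real.logb Λ (n : ℝ) :=
  Real.logb_le_logb_of_le hΛ (by exact_mod_cast hm) (by exact_mod_cast hmn)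

/-- `log_Λ #box X = Σᵢ αᵢ`. [folklore] -/
theorem logb_card_dyadicBox {d : ℕ} {X : Fin d → ℕ} (hX : ∀ i, 0 < X i) :
    Real.logb Λ ((dyadicBox X).card : ℝ) = ∑ i, expo Λ X i := by
  rw [card_dyadicBox, logb_natProd _ fun i _ => hX i]; rfl

/-- `log_Λ #subBox S X = Σ_{i∉S} αᵢ = Σᵢ αᵢ - Σ_{i∈S} αᵢ`. [folklore] -/
theorem logb_card_subBox {d : ℕ} (S : Finset (Fin d)) {X : Fin d → ℕ} (hX : ∀ i, 0 < X i) :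
    Real.logb Λ ((subBox S X).card : ℝ) = ∑ i, expo Λ X i - ∑ i ∈ S, expo Λ X i := by
  classical
  rw [card_subBox, logb_natProd _ fun i _ => hX i, eq_sub_iff_add_eq]
  exact Finset.sum_compl_add_sum S _

/-- `log_Λ W_S(X) = Σ_{i∈S} (i+1) αᵢ`. [folklore] -/
theorem logb_onVal {d : ℕ} (S : Finset (Fin d)) {X : Fin d → ℕ} (hX : ∀ i, 0 < X i) :
    Real.logb Λ ((onVal S X : ℕ) : ℝ) = ∑ i ∈ S, ((i : ℕ) + 1 : ℝ) * expo Λ X i := by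
  rw [onVal, logb_natProd S (f := fun i : Fin d => X i ^ ((i : ℕ) + 1)) fun i _ => pow_pos (hX i) _]
  exact sum_congr rfl fun i _ => by rw [logb_natPow]; push_cast; rfl

/-- `log_Λ W_S(2X) = Σ_{i∈S} (i+1) (log_Λ 2 + αᵢ)`. [folklore] -/
theorem logb_onVal_two_mul {d : ℕ} (S : Finset (Fin d)) {X : Fin d → ℕ} (hX : ∀ i, 0 < X i) :
    Real.logb Λ ((onVal S (fun i => 2 * X i) : ℕ) : ℝ) =
      ∑ i ∈ S, ((i : ℕ) + 1 : ℝ) * (Real.logb Λ 2 + expo Λ X i) := by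
  rw [onVal, logb_natProd S (f := fun i : Fin d => (2 * X i) ^ ((i : ℕ) + 1)) fun i _ =>
    pow_pos (Nat.mul_pos two_pos (hX i)) _]
  refine sum_congr rfl fun i _ => ?_
  rw [logb_natPow, logb_natMul two_pos (hX i)]
  push_cast; rfl

/-- `log_Λ ∏ᵢ Xᵢ^{i+1} = Σᵢ (i+1) αᵢ`. [folklore] -/
theorem logb_shapeVal {d : ℕ} {X : Fin d → ℕ} (hX : ∀ i, 0 < X i) :
    Real.logb Λ ((shapeVal X : ℕ) : ℝ) = ∑ i : Fin d, ((i : ℕ) + 1 : ℝ) * expo Λ X i := by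
  rw [shapeVal, logb_natProd (univ : Finset (Fin d)) (f := fun i : Fin d => X i ^ ((i : ℕ) + 1))
    fun i _ => pow_pos (hX i) _]
  exact sum_congr rfl fun i _ => by rw [logb_natPow]; push_cast; rfl

end dictionary

/-! ### The three bounds in exponent form -/

section bounds

variable {d : ℕ} {c₁ c₂ c₃ : ℕ} (hc₁ : 0 < c₁) (hc₂ : 0 < c₂) (hc₃ : 0 < c₃)
  {X Y Z : Fin d → ℕ} (hX : ∀ i, 0 < X i) (hY : ∀ i, 0 < Y i) (hZ : ∀ i, 0 < Z i)
  {T Dτ : ℕ} (hTX : c₁ * shapeVal (fun i => 2 * X i) ≤ T) (hTY : c₂ * shapeVal (fun i => 2 * Y i) ≤ T)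
  (hTZ : c₃ * shapeVal (fun i => 2 * Z i) ≤ T) (hD : ∀ m : ℕ, m ≠ 0 → m ≤ T → m.divisors.card ≤ Dτ)
  {Λ : ℝ} (hΛ : 1 < Λ) (hB : 0 < shapeCount c₁ c₂ c₃ X Y Z)
include hc₁ hc₂ hc₃ hX hY hZ hTX hTY hTZ hD hΛ hB

/-- **(6.4), the trivial bound in exponent form**: with `D = log_Λ B`, `a = Σ αᵢ` etc.,
`D ≤ a + b + d log_Λ D_τ`, `D ≤ a + c + …`, `D ≤ b + c + …`. [cite: BernertEtAl2024, Proposition 6.1] -/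
theorem trivial_linear :
    Real.logb Λ (shapeCount c₁ c₂ c₃ X Y Z) ≤ ∑ i, expo Λ X i + ∑ i, expo Λ Y i + d * Real.logb Λ Dτ ∧
    Real.logb Λ (shapeCount c₁ c₂ c₃ X Y Z) ≤ ∑ i, expo Λ X i + ∑ i, expo Λ Z i + d * Real.logb Λ Dτ ∧
    Real.logb Λ (shapeCount c₁ c₂ c₃ X Y Z) ≤ ∑ i, expo Λ Y i + ∑ i, expo Λ Z i + d * Real.logb Λ Dτ := by
  have hBN := shapeCount_le_tripleCount c₁ c₂ c₃ X Y Z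
  have h1 := tripleCount_le_XY c₁ c₂ hc₃ X Y Z hZ (fun m hm hmT => hD m hm (hmT.trans hTZ))
  have h2 := tripleCount_le_XZ c₁ hc₂ c₃ X Y Z hY (fun m hm hmT => hD m hm (hmT.trans hTY))
  have h3 := tripleCount_le_YZ hc₁ c₂ c₃ X Y Z hX (fun m hm hmT => hD m hm (hmT.trans hTX))
  have hDτ : 1 ≤ Dτ := by
    have h1 : (1 : ℕ) ≤ T := le_trans (Nat.mul_pos hc₃ (shapeVal_pos fun i => Nat.mul_pos two_pos (hZ i))) hTZ
    simpa using hD 1 one_ne_zero h1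
  have key : ∀ {U V : Fin d → ℕ}, (∀ i, 0 < U i) → (∀ i, 0 < V i) →
      shapeCount c₁ c₂ c₃ X Y Z ≤ (dyadicBox U).card * (dyadicBox V).card * Dτ ^ d →
      Real.logb Λ (shapeCount c₁ c₂ c₃ X Y Z) ≤ ∑ i, expo Λ U i + ∑ i, expo Λ V i + d * Real.logb Λ Dτ := by
    intro U V hU hV h
    have hU0 : 0 < (dyadicBox U).card := by rw [card_dyadicBox]; exact prod_pos fun i _ => hU i
    have hV0 : 0 < (dyadicBox V).card := by rw [card_dyadicBox]; exact prod_pos fun i _ => hV i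
    calc Real.logb Λ (shapeCount c₁ c₂ c₃ X Y Z)
        ≤ Real.logb Λ (((dyadicBox U).card * (dyadicBox V).card * Dτ ^ d : ℕ) : ℝ) :=
          logb_natMono hΛ hB h
      _ = _ := by
          rw [logb_natMul (Nat.mul_pos hU0 hV0) (pow_pos hDτ _), logb_natMul hU0 hV0,
            logb_card_dyadicBox hU, logb_card_dyadicBox hV, logb_natPow]
  exact ⟨key hX hY (hBN.trans h1), key hX hZ (hBN.trans h2), key hY hZ (hBN.trans h3)⟩

/-- **(6.10), the Fourier bound in exponent form**: for saved sets `S_U, S_V, S_W` (exponents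
`i+1` multiples of `e_T ≥ 2`), `Σ_{S_U} α + Σ_{S_V} β + Σ_{S_W} γ ≤ 4L - 6D + (log_Λ 27 + (12d+3) log_Λ D_τ)`.
[cite: BernertEtAl2024, Proposition 6.1] -/
theorem fourier_linear (SU SV SW : Finset (Fin d)) {eU eV eW : ℕ} (heU : 2 ≤ eU) (heV : 2 ≤ eV)
    (heW : 2 ≤ eW) (hSU : ∀ i ∈ SU, eU ∣ (i : ℕ) + 1) (hSV : ∀ i ∈ SV, eV ∣ (i : ℕ) + 1)
    (hSW : ∀ i ∈ SW, eW ∣ (i : ℕ) + 1) :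
    ∑ i ∈ SU, expo Λ X i + ∑ i ∈ SV, expo Λ Y i + ∑ i ∈ SW, expo Λ Z i ≤
      4 * (∑ i, expo Λ X i + ∑ i, expo Λ Y i + ∑ i, expo Λ Z i) -
        6 * Real.logb Λ (shapeCount c₁ c₂ c₃ X Y Z) +
        (Real.logb Λ 27 + (12 * d + 3) * Real.logb Λ Dτ) := by
  have h := shapeCount_pow_six_mul_le_sets hc₁ hc₂ hc₃ X Y Z hX hY hZ SU SV SW heU heV heW hSU hSV hSW
    hTX hTY hTZ hD
  have hDτ : 1 ≤ Dτ := by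
    have h1 : (1 : ℕ) ≤ T := le_trans (Nat.mul_pos hc₃ (shapeVal_pos fun i => Nat.mul_pos two_pos (hZ i))) hTZ
    simpa using hD 1 one_ne_zero h1
  set B := shapeCount c₁ c₂ c₃ X Y Z with hBdef
  have hNX : 0 < (dyadicBox X).card := by rw [card_dyadicBox]; exact prod_pos fun i _ => hX i
  have hNY : 0 < (dyadicBox Y).card := by rw [card_dyadicBox]; exact prod_pos fun i _ => hY i
  have hNZ : 0 < (dyadicBox Z).card := by rw [card_dyadicBox]; exact prod_pos fun i _ => hZ i
  have hPU : 0 < ∏ i ∈ SU, X i := prod_pos fun i _ => hX i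
  have hPV : 0 < ∏ i ∈ SV, Y i := prod_pos fun i _ => hY i
  have hPW : 0 < ∏ i ∈ SW, Z i := prod_pos fun i _ => hZ i
  have hlog := logb_natMono hΛ (Nat.mul_pos (pow_pos hB 6) (Nat.mul_pos (Nat.mul_pos hPU hPV) hPW)) h
  rw [logb_natMul (pow_pos hB 6) (Nat.mul_pos (Nat.mul_pos hPU hPV) hPW), logb_natPow,
    logb_natMul (Nat.mul_pos hPU hPV) hPW, logb_natMul hPU hPV,
    logb_natProd _ (fun i _ => hX i), logb_natProd _ (fun i _ => hY i),
    logb_natProd _ (fun i _ => hZ i),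
    logb_natMul (Nat.mul_pos (by norm_num) (pow_pos hDτ _)) (pow_pos (Nat.mul_pos (Nat.mul_pos hNX hNY) hNZ) 4),
    logb_natMul (by norm_num) (pow_pos hDτ _), logb_natPow, logb_natPow,
    logb_natMul (Nat.mul_pos hNX hNY) hNZ, logb_natMul hNX hNY,
    logb_card_dyadicBox hX, logb_card_dyadicBox hY, logb_card_dyadicBox hZ] at hlog
  simp only [expo] at hlog ⊢
  push_cast at hlog ⊢
  linarith

set_option maxHeartbeats 800000 in
-- a long bookkeeping proof with many `logb` rewrites
/-- **(6.5)–(6.9), the geometry bound in exponent form**: for index sets `I, J, K` and any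
`s ≥ 3d log_Λ D_τ + (8 + Σ_I (i+1) + Σ_J (i+1)) log_Λ 2 + log_Λ V₂`, where `V₂ = ∏ 2^{i+1}`
and `C₀ ≤ V₂ c₃ ∏ Zᵢ^{i+1}`, `Λ = 2C₀`: either `Σ_I α + Σ_J β + Σ_K γ ≤ L - D + s` or
`1 - (Σ_I i αᵢ + Σ_J i βᵢ + Σ_K i γᵢ) ≤ L - D + s`. [cite: BernertEtAl2024, Proposition 6.1] -/
theorem geometry_disjunction {C₀ : ℕ} (hC₀ : 1 ≤ C₀) (hΛC : Λ = 2 * C₀)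
    (hC₀le : C₀ ≤ shapeVal (fun _ : Fin d => 2) * (c₃ * shapeVal Z)) (I J K : Finset (Fin d))
    {s : ℝ} (hs : 3 * d * Real.logb Λ Dτ + (8 + ∑ i ∈ I, ((i : ℕ) + 1 : ℝ) + ∑ i ∈ J, ((i : ℕ) + 1 : ℝ)) *
      Real.logb Λ 2 + Real.logb Λ (shapeVal (fun _ : Fin d => 2) : ℕ) ≤ s) :
    (∑ i ∈ I, expo Λ X i + ∑ i ∈ J, expo Λ Y i + ∑ i ∈ K, expo Λ Z i ≤
      (∑ i, expo Λ X i + ∑ i, expo Λ Y i + ∑ i, expo Λ Z i) - Real.logb Λ (shapeCount c₁ c₂ c₃ X Y Z) + s) ∨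
    (1 - (∑ i ∈ I, (i : ℝ) * expo Λ X i + ∑ i ∈ J, (i : ℝ) * expo Λ Y i + ∑ i ∈ K, (i : ℝ) * expo Λ Z i) ≤
      (∑ i, expo Λ X i + ∑ i, expo Λ Y i + ∑ i, expo Λ Z i) - Real.logb Λ (shapeCount c₁ c₂ c₃ X Y Z) + s) := by
  classical
  have hgeo := shapeCount_le_geometry_sets hc₁ hc₂ hc₃ X Y Z hX hY hZ I J K hTX hTY hTZ hD
  have hDτ : 1 ≤ Dτ := by
    have h1 : (1 : ℕ) ≤ T := le_trans (Nat.mul_pos hc₃ (shapeVal_pos fun i => Nat.mul_pos two_pos (hZ i))) hTZ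
    simpa using hD 1 one_ne_zero h1
  set B := shapeCount c₁ c₂ c₃ X Y Z with hBdef
  set V2 : ℕ := shapeVal (fun _ : Fin d => 2) with hV2
  have hV2pos : 0 < V2 := shapeVal_pos fun _ => two_pos
  set O : ℕ := (subBox I X).card * (subBox J Y).card * (subBox K Z).card with hO
  have hOI : 0 < (subBox I X).card := by rw [card_subBox]; exact prod_pos fun i _ => hX i
  have hOJ : 0 < (subBox J Y).card := by rw [card_subBox]; exact prod_pos fun i _ => hY i
  have hOK : 0 < (subBox K Z).card := by rw [card_subBox]; exact prod_pos fun i _ => hZ i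
  have hO0 : 0 < O := Nat.mul_pos (Nat.mul_pos hOI hOJ) hOK
  set W₁ : ℕ := onVal I (fun i => 2 * X i) with hW₁
  set W₂ : ℕ := onVal J (fun i => 2 * Y i) with hW₂
  have hW₁0 : 0 < W₁ := prod_pos fun i _ => pow_pos (Nat.mul_pos two_pos (hX i)) _
  have hW₂0 : 0 < W₂ := prod_pos fun i _ => pow_pos (Nat.mul_pos two_pos (hY i)) _
  set off : ℕ := c₃ * offVal K Z with hoff
  have hoff0 : 0 < off := Nat.mul_pos hc₃ (prod_pos fun i _ => pow_pos (hZ i) _)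
  -- real positivity
  have hΛ0 : 0 < Λ := by linarith
  have hB' : (0 : ℝ) < B := by exact_mod_cast hB
  have hO' : (0 : ℝ) < O := by exact_mod_cast hO0
  have hDτ' : (1 : ℝ) ≤ Dτ := by exact_mod_cast hDτ
  have hW₁' : (0 : ℝ) < W₁ := by exact_mod_cast hW₁0
  have hW₂' : (0 : ℝ) < W₂ := by exact_mod_cast hW₂0
  have hoff' : (0 : ℝ) < off := by exact_mod_cast hoff0
  have hl2 : 0 ≤ Real.logb Λ 2 := Real.logb_nonneg hΛ (by norm_num)
  have hlD : 0 ≤ Real.logb Λ Dτ := Real.logb_nonneg hΛ hDτ'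
  have hlV : 0 ≤ Real.logb Λ (V2 : ℝ) := Real.logb_nonneg hΛ (by exact_mod_cast hV2pos)
  -- the two terms
  set x : ℝ := (O : ℝ) * (Dτ : ℝ) ^ (3 * d) * 2 with hx
  set y : ℝ := (O : ℝ) * (Dτ : ℝ) ^ (3 * d) * (28 * (W₁ : ℝ) * W₂ / off) with hy
  have hxy : (B : ℝ) ≤ x + y := by
    have : (B : ℝ) ≤ (O : ℝ) * (Dτ : ℝ) ^ (3 * d) * (2 + 28 * (W₁ : ℝ) * W₂ / off) := by
      simpa only [hO, hW₁, hW₂, hoff] using hgeo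
    linarith [this, show (O : ℝ) * (Dτ : ℝ) ^ (3 * d) * (2 + 28 * (W₁ : ℝ) * W₂ / off) = x + y by
      rw [hx, hy]; ring]
  have hx0 : 0 < x := by positivity
  have hy0 : 0 < y := by positivity
  -- logarithms of the ingredients
  have hlogO : Real.logb Λ O = (∑ i, expo Λ X i - ∑ i ∈ I, expo Λ X i) +
      (∑ i, expo Λ Y i - ∑ i ∈ J, expo Λ Y i) + (∑ i, expo Λ Z i - ∑ i ∈ K, expo Λ Z i) := by
    rw [hO, logb_natMul (Nat.mul_pos hOI hOJ) hOK, logb_natMul hOI hOJ,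
      logb_card_subBox I hX, logb_card_subBox J hY, logb_card_subBox K hZ]
  have hlogDτ : Real.logb Λ ((Dτ : ℝ) ^ (3 * d)) = (3 * d : ℝ) * Real.logb Λ Dτ := by
    rw [← Real.rpow_natCast, Real.logb_rpow_eq_mul_logb_of_pos (by linarith)]; push_cast; ring
  have hlogW₁ := logb_onVal_two_mul (Λ := Λ) I hX
  have hlogW₂ := logb_onVal_two_mul (Λ := Λ) J hY
  -- `log_Λ off ≥ 1 - log_Λ 2 - log_Λ V₂ - Σ_K (i+1) γᵢ`
  have hlogoff : 1 - Real.logb Λ 2 - Real.logb Λ (V2 : ℝ) - ∑ i ∈ K, ((i : ℕ) + 1 : ℝ) * expo Λ Z i ≤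
      Real.logb Λ off := by
    have h1 : off * onVal K Z = c₃ * shapeVal Z := by
      rw [hoff, shapeVal_eq_offVal_mul_onVal K Z]; ring
    have h2 : Real.logb Λ off + ∑ i ∈ K, ((i : ℕ) + 1 : ℝ) * expo Λ Z i = Real.logb Λ ((c₃ * shapeVal Z : ℕ) : ℝ) := by
      rw [← h1, logb_natMul hoff0 (show 0 < onVal K Z from prod_pos fun i _ => pow_pos (hZ i) _),
        logb_onVal K hZ]
    have h3 : Real.logb Λ (C₀ : ℝ) ≤ Real.logb Λ (V2 : ℝ) + Real.logb Λ ((c₃ * shapeVal Z : ℕ) : ℝ) := by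
      rw [← logb_natMul hV2pos (Nat.mul_pos hc₃ (shapeVal_pos hZ))]
      exact logb_natMono hΛ (by omega) hC₀le
    have h4 : Real.logb Λ (C₀ : ℝ) = 1 - Real.logb Λ 2 := by
      have : (C₀ : ℝ) = Λ / 2 := by rw [hΛC]; ring
      rw [this, Real.logb_div (by linarith) (by norm_num), Real.logb_self_eq_one hΛ]
    linarith
  rcases le_or_gt y x with hyx | hxy'
  · -- `B ≤ 2x`
    left
    have h1 : (B : ℝ) ≤ 2 * x := by linarith
    have h2 : Real.logb Λ B ≤ Real.logb Λ 2 + Real.logb Λ x := by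
      rw [← Real.logb_mul (by norm_num) hx0.ne']
      exact Real.logb_le_logb_of_le hΛ hB' h1
    have h3 : Real.logb Λ x = Real.logb Λ O + (3 * d : ℝ) * Real.logb Λ Dτ + Real.logb Λ 2 := by
      rw [hx, Real.logb_mul (by positivity) (by norm_num), Real.logb_mul hO'.ne' (by positivity), hlogDτ]
    rw [h3, hlogO] at h2
    have hIJ : 0 ≤ (∑ i ∈ I, ((i : ℕ) + 1 : ℝ) + ∑ i ∈ J, ((i : ℕ) + 1 : ℝ)) * Real.logb Λ 2 :=
      mul_nonneg (add_nonneg (sum_nonneg fun i _ => by positivity) (sum_nonneg fun i _ => by positivity)) hl2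
    linarith
  · -- `B ≤ 2y`
    right
    have h1 : (B : ℝ) ≤ 2 * y := by linarith
    have h2 : Real.logb Λ B ≤ Real.logb Λ 2 + Real.logb Λ y := by
      rw [← Real.logb_mul (by norm_num) hy0.ne']
      exact Real.logb_le_logb_of_le hΛ hB' h1
    have h3 : Real.logb Λ y = Real.logb Λ O + (3 * d : ℝ) * Real.logb Λ Dτ +
        (Real.logb Λ 28 + Real.logb Λ W₁ + Real.logb Λ W₂ - Real.logb Λ off) := by
      rw [hy, Real.logb_mul (by positivity) (by positivity), Real.logb_mul hO'.ne' (by positivity), hlogDτ,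
        Real.logb_div (by positivity) hoff'.ne', Real.logb_mul (by positivity) hW₂'.ne',
        Real.logb_mul (by norm_num) hW₁'.ne']
    have h28 : Real.logb Λ 28 ≤ 5 * Real.logb Λ 2 := by
      have : Real.logb Λ 28 ≤ Real.logb Λ 32 := Real.logb_le_logb_of_le hΛ (by norm_num) (by norm_num)
      have h32 : Real.logb Λ 32 = 5 * Real.logb Λ 2 := by
        rw [show (32 : ℝ) = 2 ^ (5 : ℕ) by norm_num, ← Real.rpow_natCast,
          Real.logb_rpow_eq_mul_logb_of_pos two_pos]; norm_num
      linarith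
    rw [h3, hlogO, hlogW₁, hlogW₂] at h2
    -- expand `Σ (i+1)(log 2 + α) = Σ (i+1) α + (Σ (i+1)) log 2` and `Σ (i+1) α - Σ α = Σ i α`
    have eI : ∑ i ∈ I, ((i : ℕ) + 1 : ℝ) * (Real.logb Λ 2 + expo Λ X i) =
        ∑ i ∈ I, (i : ℝ) * expo Λ X i + ∑ i ∈ I, expo Λ X i + (∑ i ∈ I, ((i : ℕ) + 1 : ℝ)) * Real.logb Λ 2 := by
      rw [sum_mul, ← sum_add_distrib, ← sum_add_distrib]; exact sum_congr rfl fun i _ => by ring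
    have eJ : ∑ i ∈ J, ((i : ℕ) + 1 : ℝ) * (Real.logb Λ 2 + expo Λ Y i) =
        ∑ i ∈ J, (i : ℝ) * expo Λ Y i + ∑ i ∈ J, expo Λ Y i + (∑ i ∈ J, ((i : ℕ) + 1 : ℝ)) * Real.logb Λ 2 := by
      rw [sum_mul, ← sum_add_distrib, ← sum_add_distrib]; exact sum_congr rfl fun i _ => by ring
    have eK : ∑ i ∈ K, ((i : ℕ) + 1 : ℝ) * expo Λ Z i = ∑ i ∈ K, (i : ℝ) * expo Λ Z i + ∑ i ∈ K, expo Λ Z i := by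
      rw [← sum_add_distrib]; exact sum_congr rfl fun i _ => by ring
    rw [eI, eJ] at h2
    rw [eK] at hlogoff
    linarith

end bounds

end AbcShapes

end Literature.NumberTheory.DiophantineGeometry
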